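import Summits.MatrixMultiplication.MatrixMultiplication.Theorems.ObstructionDescentUniversalOccurrenceTwoRectangleStorey
import Summits.MatrixMultiplication.MatrixMultiplication.Theorems.ObstructionDescentUniversalOccurrenceTwoRectangleCrossLiftArith
import Summits.MatrixMultiplication.MatrixMultiplication.Theorems.ObstructionDescentUniversalOccurrenceTwoRectangleOddThreeArith
import Summits.MatrixMultiplication.MatrixMultiplication.Theorems.ObstructionDescentUniversalOccurrenceTwoRectangleFourOddArith
import Summits.MatrixMultiplication.MatrixMultiplication.Theorems.ObstructionDescentUniversalOccurrenceTwoRectangleFourOddSign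
import Summits.MatrixMultiplication.MatrixMultiplication.Theorems.ObstructionDescentUniversalOccurrenceTwoRectangleFourOddDominoes

set_option linter.dupNamespace false
set_option autoImplicit false

/-!
# Universal occurrence — two rectangles and the four-odd types `(2N-2j-3,2j+1,1,1)`: the value of a lifted term, uniform in `j`
(decomp-mm · lens 3 · gen 44, K32-E)

Route `route-MatrixMultiplication-ObstructionDescent` (sub-problem `MatrixMultiplication`, `ω(ℂ) = 2`); SUPPORT for the crux
`NoOccurrenceObstruction` (`P_O`, item `stmt-MatrixMultiplication-29040`), universal-occurrence programme.  No `def`, no `sorry`.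

THE HEART of the hook-domino family `((2^N),(2^N),(2N-2j-3,2j+1,1,1))`, UNIFORM IN `j` (main theorem: `…TwoRectangleFourOdd`):
in the storey pairing of the LIFTED DESIGN `D'_j(N)` — alphabet `[N+2]`, legs `φ = (0,…,N-1 | 0,1)`, `ψ = (0,…,N-1 | 1,0)`
(crossed), `γ(n) = 1` for `1 ≤ n ≤ j+1`, `γ(N) = 2`, `γ(N+1) = 3`, `γ = 0` otherwise, read into the polytabloid `e_T` of the
`(2N-2j-3,2j+1,1,1)` tableau of `…FourOddTableaux`, blocks `e = (q mod 2, q div 2)` and `e' = e ∘ (p₀ p₁)` — EVERY NON-ZERO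
TERM EQUALS `(-1)^{j+1}` (`fourOdd_liftTerm_eq`; `j = 1, 2` are `oddThree_liftTerm_eq_one`, `oddFive_liftTerm_eq_neg_one`).
Proof: the block bijections `x = φ∘ι` and `χ = ψ∘ι∘(p₀ p₁)` agree off the column, so `χ = x∘ρ` with
`ρ ∈ {1,(p₀p₂),(p₁p₃),(p₀p₂)(p₁p₃)}` (`bijective_agree_off_two`); the value `e_T(γ∘ι) = (-1)^{inv(column) + D}`,
`D = Σ_{i<2j} w(2i+4)` (`…FourOddSign`), the domino sum `D + … = j+1` (`…FourOddDominoes`) and the `j`-free local sign rule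
of `…OddThreeArith` on the model alphabet `[6]` (applied with `t = 2 - …` in place of that family's domino sum, so that
`D ≡ t + j + 1 (mod 2)`) make the term equal to `(-1)^{j+1}`: each further domino flips the uniform sign
(censuses: `+320` terms at `(N,j) = (5,1)`, `-5376` at `(6,2)`, `+2332800` at `(8,3)`).

[cite: BurgisserIkenmeyer2011, Thm. 4.4, Lemma 6.1] [cite: BurgisserIkenmeyer2017, §5, Thm. 5.9 (proof of (2)), eq. (3.4)]
-/

noncomputable section

open scoped BigOperators

namespace Summit.MatrixMultiplication.MatrixMultiplication.Theorems.ObstructionCalculus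

open Literature.Computability.AlgebraicComplexity
open Literature.NumberTheory.DiophantineGeometry

set_option maxHeartbeats 800000 in
/-- **Every non-zero term of the lifted design `D'_j(N)` equals `(-1)^{j+1}`** (`2j+2 ≤ N`; `T` the `(2N-2j-3,2j+1,1,1)`
tableau, `e` the parity blocks, `κ = (p₀ p₁)`). [this node] -/
theorem fourOdd_liftTerm_eq {N j : ℕ} (hN : 2 * j + 2 ≤ N) {Y : YoungDiagram} (hNY : ∀ c ∈ Y.cells, c.1 < N)
    (T : StdFilling (N * 2) Y)
    (hT : ∀ p : Fin (N * 2), T.1 p =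
      (if (p : ℕ) < 4 then ((p : ℕ), 0) else if (p : ℕ) < 4 * j + 4 then ((p : ℕ) % 2, (p : ℕ) / 2 - 1)
        else (0, (p : ℕ) - (2 * j + 3))))
    (e : Fin (N * 2) ≃ Fin 2 × Fin N)
    (hev : ∀ q : Fin (N * 2), (((e q).1 : Fin 2) : ℕ) = (q : ℕ) % 2 ∧ (((e q).2 : Fin N) : ℕ) = (q : ℕ) / 2)
    (κ : Equiv.Perm (Fin (N * 2)))
    (hκv : ∀ q : Fin (N * 2), ((κ q : Fin (N * 2)) : ℕ) = if (q : ℕ) = 0 then 1 else if (q : ℕ) = 1 then 0 else (q : ℕ))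
    (φ ψ γ : Fin (N + 2) → Fin N)
    (hφv : ∀ r, ((φ r : Fin N) : ℕ) = if (r : ℕ) < N then (r : ℕ) else (r : ℕ) - N)
    (hψv : ∀ r, ((ψ r : Fin N) : ℕ) = if (r : ℕ) < N then (r : ℕ) else N + 1 - (r : ℕ))
    (hγv : ∀ r, ((γ r : Fin N) : ℕ) = if (r : ℕ) = 0 then 0 else if (r : ℕ) < j + 2 then 1
      else if (r : ℕ) = N then 2 else if (r : ℕ) = N + 1 then 3 else 0)
    (ι : Fin (N * 2) → Fin (N + 2))
    (hne : wordBlockSign ℂ e (φ ∘ ι) * (wordBlockSign ℂ e ((ψ ∘ ι) ∘ ⇑κ) * T.polytabloid ℂ hNY (γ ∘ ι)) ≠ 0) :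
    wordBlockSign ℂ e (φ ∘ ι) * (wordBlockSign ℂ e ((ψ ∘ ι) ∘ ⇑κ) * T.polytabloid ℂ hNY (γ ∘ ι)) =
      if j % 2 = 0 then -1 else 1 := by
  classical
  have hj4 : 4 * j + 4 ≤ N * 2 := by omega
  have hN' : j + 2 ≤ N := by omega
  -- the column `p₀ p₁ p₂ p₃`, the slots `s₀ s₁`
  obtain ⟨p0, hp0⟩ : ∃ p : Fin (N * 2), (p : ℕ) = 0 := ⟨⟨0, by omega⟩, rfl⟩
  obtain ⟨p1, hp1⟩ : ∃ p : Fin (N * 2), (p : ℕ) = 1 := ⟨⟨1, by omega⟩, rfl⟩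
  obtain ⟨p2, hp2⟩ : ∃ p : Fin (N * 2), (p : ℕ) = 2 := ⟨⟨2, by omega⟩, rfl⟩
  obtain ⟨p3, hp3⟩ : ∃ p : Fin (N * 2), (p : ℕ) = 3 := ⟨⟨3, by omega⟩, rfl⟩
  have hpne : ∀ {q q' : Fin (N * 2)}, (q : ℕ) ≠ (q' : ℕ) → q ≠ q' := fun h hqq' => h (congrArg Fin.val hqq')
  have hp01 : p0 ≠ p1 := hpne (by omega); have hp02 : p0 ≠ p2 := hpne (by omega)
  have hp03 : p0 ≠ p3 := hpne (by omega); have hp12 : p1 ≠ p2 := hpne (by omega)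
  have hp13 : p1 ≠ p3 := hpne (by omega); have hp23 : p2 ≠ p3 := hpne (by omega)
  have hP0 : (⟨0, by omega⟩ : Fin (N * 2)) = p0 := Fin.ext (by rw [hp0])
  have hP1 : (⟨1, by omega⟩ : Fin (N * 2)) = p1 := Fin.ext (by rw [hp1])
  have hP2 : (⟨2, by omega⟩ : Fin (N * 2)) = p2 := Fin.ext (by rw [hp2])
  have hP3 : (⟨3, by omega⟩ : Fin (N * 2)) = p3 := Fin.ext (by rw [hp3])
  have hcases : ∀ q : Fin (N * 2), (q : ℕ) < 4 → q = p0 ∨ q = p1 ∨ q = p2 ∨ q = p3 := by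
    intro q hq
    have h : (q : ℕ) = 0 ∨ (q : ℕ) = 1 ∨ (q : ℕ) = 2 ∨ (q : ℕ) = 3 := by omega
    rcases h with h | h | h | h
    · exact Or.inl (Fin.ext (by rw [h, hp0]))
    · exact Or.inr (Or.inl (Fin.ext (by rw [h, hp1])))
    · exact Or.inr (Or.inr (Or.inl (Fin.ext (by rw [h, hp2]))))
    · exact Or.inr (Or.inr (Or.inr (Fin.ext (by rw [h, hp3]))))
  obtain ⟨s0, hs0⟩ : ∃ s : Fin N, (s : ℕ) = 0 := ⟨⟨0, by omega⟩, rfl⟩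
  obtain ⟨s1, hs1⟩ : ∃ s : Fin N, (s : ℕ) = 1 := ⟨⟨1, by omega⟩, rfl⟩
  have hs01 : s0 ≠ s1 := by rw [Ne, Fin.ext_iff, hs0, hs1]; omega
  have hesymm : ∀ (a : Fin 2) (j : Fin N), ((e.symm (a, j) : Fin (N * 2)) : ℕ) = (a : ℕ) + 2 * (j : ℕ) := by
    intro a j
    obtain ⟨ha, hj⟩ := hev (e.symm (a, j))
    rw [Equiv.apply_symm_apply] at ha hj
    dsimp only at ha hj
    omega
  have hq00 : e.symm (0, s0) = p0 := Fin.ext (by rw [hesymm, hp0, hs0]; simp)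
  have hq10 : e.symm (1, s0) = p1 := Fin.ext (by rw [hesymm, hp1, hs0]; simp)
  have hq01 : e.symm (0, s1) = p2 := Fin.ext (by rw [hesymm, hp2, hs1]; simp)
  have hq11 : e.symm (1, s1) = p3 := Fin.ext (by rw [hesymm, hp3, hs1]; simp)
  have hblk02 : (e p0).1 = (e p2).1 := Fin.ext (by rw [(hev p0).1, (hev p2).1]; omega)
  have hblk13 : (e p1).1 = (e p3).1 := Fin.ext (by rw [(hev p1).1, (hev p3).1]; omega)
  have hκ0 : κ p0 = p1 := Fin.ext (by rw [hκv, hp0, hp1]; simp)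
  have hκ1 : κ p1 = p0 := Fin.ext (by rw [hκv, hp1, hp0]; simp)
  have hκq : ∀ q : Fin (N * 2), (q : ℕ) ≠ 0 → (q : ℕ) ≠ 1 → κ q = q := fun q hq0 hq1 =>
    Fin.ext (by rw [hκv, if_neg hq0, if_neg hq1])
  -- the three words of the term
  set x : Word N (N * 2) := φ ∘ ι with hxdef
  set χ : Word N (N * 2) := (ψ ∘ ι) ∘ ⇑κ with hχdef
  set w : Word N (N * 2) := γ ∘ ι with hwdef
  have hx0 : wordBlockSign ℂ e x ≠ 0 := fun h => hne (by rw [h, zero_mul])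
  have hχ0 : wordBlockSign ℂ e χ ≠ 0 := fun h => hne (by rw [h, zero_mul, mul_zero])
  have hw0 : StdFilling.polytabloid ℂ hNY T w ≠ 0 := fun h => hne (by rw [h, mul_zero, mul_zero])
  obtain ⟨harm, hlt, hinj, hdom, hds⟩ := fourOddTableau_support hNY T hT hw0
  have hxv : ∀ q, ((x q : Fin N) : ℕ) =
      if ((ι q : Fin (N + 2)) : ℕ) < N then ((ι q : Fin (N + 2)) : ℕ) else ((ι q : Fin (N + 2)) : ℕ) - N :=
    fun q => hφv (ι q)
  have hχv : ∀ q, ((χ q : Fin N) : ℕ) =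
      if ((ι (κ q) : Fin (N + 2)) : ℕ) < N then ((ι (κ q) : Fin (N + 2)) : ℕ) else N + 1 - ((ι (κ q) : Fin (N + 2)) : ℕ) :=
    fun q => hψv (ι (κ q))
  have hwv : ∀ q, ((w q : Fin N) : ℕ) =
      if ((ι q : Fin (N + 2)) : ℕ) = 0 then 0 else if ((ι q : Fin (N + 2)) : ℕ) < j + 2 then 1
        else if ((ι q : Fin (N + 2)) : ℕ) = N then 2 else if ((ι q : Fin (N + 2)) : ℕ) = N + 1 then 3 else 0 :=
    fun q => hγv (ι q)
  -- off the column (dominoes and arm) the letters are `< N`, so `x` and `χ` agree there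
  have hagree : ∀ q : Fin (N * 2), 4 ≤ (q : ℕ) → χ q = x q := by
    intro q hq
    have hlt' : ((ι q : Fin (N + 2)) : ℕ) < N := by
      have := (ι q).2
      by_cases hq12 : 4 * j + 4 ≤ (q : ℕ)
      · have h1 := harm q hq12
        rw [hwv] at h1
        split_ifs at h1
        all_goals omega
      · have h1 := hdom q hq (by omega)
        rw [hwv] at h1
        split_ifs at h1
        all_goals omega
    apply Fin.ext
    rw [hxv, hχv, hκq q (by omega) (by omega), if_pos hlt', if_pos hlt']
  -- block bijectivity and the dichotomies
  have hbx := bijective_of_wordBlockSign_ne_zero e hx0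
  have hbχ := bijective_of_wordBlockSign_ne_zero e hχ0
  have hoff : ∀ (a : Fin 2) (s : Fin N), s ≠ s0 → s ≠ s1 →
      (fun j => x (e.symm (a, j))) s = (fun j => χ (e.symm (a, j))) s := by
    intro a s h0' h1'
    have h0'' : (s : ℕ) ≠ 0 := fun h => h0' (Fin.ext (by rw [h, hs0]))
    have h1'' : (s : ℕ) ≠ 1 := fun h => h1' (Fin.ext (by rw [h, hs1]))
    exact (hagree (e.symm (a, s)) (by rw [hesymm]; omega)).symm
  have hd0 := bijective_agree_off_two (hbx 0) (hbχ 0) hs01 (hoff 0)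
  have hd1 := bijective_agree_off_two (hbx 1) (hbχ 1) hs01 (hoff 1)
  simp only [hq00, hq01] at hd0
  simp only [hq10, hq11] at hd1
  have hxi0 : x p0 ≠ x p2 := fun h => hs01 ((hbx 0).1 (by simp only [hq00, hq01]; exact h))
  have hxi1 : x p1 ≠ x p3 := fun h => hs01 ((hbx 1).1 (by simp only [hq10, hq11]; exact h))
  have hχi0 : χ p0 ≠ χ p2 := fun h => hs01 ((hbχ 0).1 (by simp only [hq00, hq01]; exact h))
  have hχi1 : χ p1 ≠ χ p3 := fun h => hs01 ((hbχ 1).1 (by simp only [hq10, hq11]; exact h))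
  -- the model letters of the four column letters
  obtain ⟨k0, hk0⟩ : ∃ k : ℕ, k = (if ((ι p0 : Fin (N + 2)) : ℕ) < 2 then ((ι p0 : Fin (N + 2)) : ℕ)
      else if ((ι p0 : Fin (N + 2)) : ℕ) < j + 2 then 2 else if ((ι p0 : Fin (N + 2)) : ℕ) < N then 3
      else ((ι p0 : Fin (N + 2)) : ℕ) + 4 - N) := ⟨_, rfl⟩
  obtain ⟨k1, hk1⟩ : ∃ k : ℕ, k = (if ((ι p1 : Fin (N + 2)) : ℕ) < 2 then ((ι p1 : Fin (N + 2)) : ℕ)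
      else if ((ι p1 : Fin (N + 2)) : ℕ) < j + 2 then 2 else if ((ι p1 : Fin (N + 2)) : ℕ) < N then 3
      else ((ι p1 : Fin (N + 2)) : ℕ) + 4 - N) := ⟨_, rfl⟩
  obtain ⟨k2, hk2⟩ : ∃ k : ℕ, k = (if ((ι p2 : Fin (N + 2)) : ℕ) < 2 then ((ι p2 : Fin (N + 2)) : ℕ)
      else if ((ι p2 : Fin (N + 2)) : ℕ) < j + 2 then 2 else if ((ι p2 : Fin (N + 2)) : ℕ) < N then 3
      else ((ι p2 : Fin (N + 2)) : ℕ) + 4 - N) := ⟨_, rfl⟩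
  obtain ⟨k3, hk3⟩ : ∃ k : ℕ, k = (if ((ι p3 : Fin (N + 2)) : ℕ) < 2 then ((ι p3 : Fin (N + 2)) : ℕ)
      else if ((ι p3 : Fin (N + 2)) : ℕ) < j + 2 then 2 else if ((ι p3 : Fin (N + 2)) : ℕ) < N then 3
      else ((ι p3 : Fin (N + 2)) : ℕ) + 4 - N) := ⟨_, rfl⟩
  have hk0lt := fourOddLetter_lt (ι p0).2 hk0; have hk1lt := fourOddLetter_lt (ι p1).2 hk1
  have hk2lt := fourOddLetter_lt (ι p2).2 hk2; have hk3lt := fourOddLetter_lt (ι p3).2 hk3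
  -- the row letters of the column are distinct (support of `e_T`)
  have hWne : ∀ q q' : Fin (N * 2), (q : ℕ) < 4 → (q' : ℕ) < 4 → (q : ℕ) ≠ (q' : ℕ) →
      (if ((ι q : Fin (N + 2)) : ℕ) = 0 then 0 else if ((ι q : Fin (N + 2)) : ℕ) < j + 2 then 1
        else if ((ι q : Fin (N + 2)) : ℕ) = N then 2 else if ((ι q : Fin (N + 2)) : ℕ) = N + 1 then 3 else 0) ≠
      (if ((ι q' : Fin (N + 2)) : ℕ) = 0 then 0 else if ((ι q' : Fin (N + 2)) : ℕ) < j + 2 then 1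
        else if ((ι q' : Fin (N + 2)) : ℕ) = N then 2 else if ((ι q' : Fin (N + 2)) : ℕ) = N + 1 then 3 else 0) := by
    intro q q' hq hq' hqq' h
    exact hqq' (congrArg Fin.val (hinj q q' hq hq' (Fin.ext (by rw [hwv, hwv]; exact h))))
  have hgen₁ : ∀ q q' : Fin (N * 2), (q : ℕ) < 4 → (q' : ℕ) < 4 → (q : ℕ) ≠ (q' : ℕ) →
      ¬ (2 ≤ ((ι q : Fin (N + 2)) : ℕ) ∧ ((ι q : Fin (N + 2)) : ℕ) < j + 2 ∧
         2 ≤ ((ι q' : Fin (N + 2)) : ℕ) ∧ ((ι q' : Fin (N + 2)) : ℕ) < j + 2) := by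
    intro q q' hq hq' hqq' hh
    exact hWne q q' hq hq' hqq'
      (by rw [fourOddLetter_col_oneGeneric (N := N) hh.1 hh.2.1, fourOddLetter_col_oneGeneric (N := N) hh.2.2.1 hh.2.2.2])
  have hgen₀ : ∀ q q' : Fin (N * 2), (q : ℕ) < 4 → (q' : ℕ) < 4 → (q : ℕ) ≠ (q' : ℕ) →
      ¬ (j + 2 ≤ ((ι q : Fin (N + 2)) : ℕ) ∧ ((ι q : Fin (N + 2)) : ℕ) < N ∧
         j + 2 ≤ ((ι q' : Fin (N + 2)) : ℕ) ∧ ((ι q' : Fin (N + 2)) : ℕ) < N) := by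
    intro q q' hq hq' hqq' hh
    exact hWne q q' hq hq' hqq'
      (by rw [fourOddLetter_col_zeroGeneric hh.1 hh.2.1, fourOddLetter_col_zeroGeneric hh.2.2.1 hh.2.2.2])
  have hW01 := hWne p0 p1 (by omega) (by omega) (by omega); have hW02 := hWne p0 p2 (by omega) (by omega) (by omega)
  have hW03 := hWne p0 p3 (by omega) (by omega) (by omega); have hW12 := hWne p1 p2 (by omega) (by omega) (by omega)
  have hW13 := hWne p1 p3 (by omega) (by omega) (by omega); have hW23 := hWne p2 p3 (by omega) (by omega) (by omega)
  rw [fourOddLetter_col hN' (ι p0).2 hk0, fourOddLetter_col hN' (ι p1).2 hk1] at hW01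
  rw [fourOddLetter_col hN' (ι p0).2 hk0, fourOddLetter_col hN' (ι p2).2 hk2] at hW02
  rw [fourOddLetter_col hN' (ι p0).2 hk0, fourOddLetter_col hN' (ι p3).2 hk3] at hW03
  rw [fourOddLetter_col hN' (ι p1).2 hk1, fourOddLetter_col hN' (ι p2).2 hk2] at hW12
  rw [fourOddLetter_col hN' (ι p1).2 hk1, fourOddLetter_col hN' (ι p3).2 hk3] at hW13
  rw [fourOddLetter_col hN' (ι p2).2 hk2, fourOddLetter_col hN' (ι p3).2 hk3] at hW23
  -- block injectivity, transferred
  have x02m := fourOddLetter_ne_fst hN' (ι p0).2 (ι p2).2 hk0 hk2 (hgen₁ p0 p2 (by omega) (by omega) (by omega))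
    (hgen₀ p0 p2 (by omega) (by omega) (by omega))
    (fun h => hxi0 (Fin.ext (by rw [hxv, hxv]; exact h)))
  have x13m := fourOddLetter_ne_fst hN' (ι p1).2 (ι p3).2 hk1 hk3 (hgen₁ p1 p3 (by omega) (by omega) (by omega))
    (hgen₀ p1 p3 (by omega) (by omega) (by omega))
    (fun h => hxi1 (Fin.ext (by rw [hxv, hxv]; exact h)))
  have y12m := fourOddLetter_ne_snd hN' (ι p1).2 (ι p2).2 hk1 hk2 (hgen₁ p1 p2 (by omega) (by omega) (by omega))
    (hgen₀ p1 p2 (by omega) (by omega) (by omega))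
    (fun h => hχi0 (Fin.ext (by rw [hχv, hχv, hκ0, hκq p2 (by omega) (by omega)]; exact h)))
  have y03m := fourOddLetter_ne_snd hN' (ι p0).2 (ι p3).2 hk0 hk3 (hgen₁ p0 p3 (by omega) (by omega) (by omega))
    (hgen₀ p0 p3 (by omega) (by omega) (by omega))
    (fun h => hχi1 (Fin.ext (by rw [hχv, hχv, hκ1, hκq p3 (by omega) (by omega)]; exact h)))
  -- the domino sum `D = Σ_{i<2j} w(2i+4)` and its bookkeeping `D + … = j + 1`
  obtain ⟨D, hDv⟩ : ∃ D : ℕ, D = ∑ i : Fin (2 * j), ((w ⟨2 * (i : ℕ) + 4, by have := i.2; omega⟩ : Fin N) : ℕ) :=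
    ⟨_, rfl⟩
  have hdd' := fourOdd_domino_sum hN e hesymm ι x w hxv hwv (hbx 0) harm hdom hp0 hp2
  rw [← hDv, fourOddLetter_dd hN' (ι p0).2 (ι p2).2 hk0 hk2 hW02] at hdd'
  have hb₁ : (if k0 = 2 ∨ k2 = 2 then 1 else 0 : ℕ) ≤ 1 := by split_ifs <;> omega
  have hb₂ : (if k0 = 1 ∨ k2 = 1 ∨ k0 = 5 ∨ k2 = 5 then 1 else 0 : ℕ) ≤ 1 := by split_ifs <;> omega
  -- the `j`-free local sign rule is applied with `t = 2 - …`, so that `D ≡ t + j + 1 (mod 2)`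
  obtain ⟨t, htv⟩ : ∃ t : ℕ,
      t = 2 - ((if k0 = 2 ∨ k2 = 2 then 1 else 0) + (if k0 = 1 ∨ k2 = 1 ∨ k0 = 5 ∨ k2 = 5 then 1 else 0)) := ⟨_, rfl⟩
  have hd3 : t < 3 := by omega
  have hdd : t + ((if k0 = 2 ∨ k2 = 2 then 1 else 0) + (if k0 = 1 ∨ k2 = 1 ∨ k0 = 5 ∨ k2 = 5 then 1 else 0)) = 2 := by
    omega
  -- the value of `e_T` as a parity, in model letters
  have hpar := fourOddTableau_apply_eq_parity hNY T hT hj4 harm hlt hinj hds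
  rw [hP0, hP1, hP2, hP3, ← hDv] at hpar
  rw [hwv p0, hwv p1, hwv p2, hwv p3, fourOddLetter_col hN' (ι p0).2 hk0, fourOddLetter_col hN' (ι p1).2 hk1,
    fourOddLetter_col hN' (ι p2).2 hk2, fourOddLetter_col hN' (ι p3).2 hk3] at hpar
  have hsq := wordBlockSign_mul_self_of_ne_zero e hx0
  -- the four dichotomy cases
  rcases hd0 with ⟨h00, h22⟩ | ⟨h02, h20⟩ <;> rcases hd1 with ⟨h11, h33⟩ | ⟨h13, h31⟩
  · -- straight / straight: `χ = x`, `inv + t` even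
    have hχx : χ = x := by
      funext q
      by_cases hq : (q : ℕ) < 4
      · rcases hcases q hq with rfl | rfl | rfl | rfl
        · exact h00.symm
        · exact h11.symm
        · exact h22.symm
        · exact h33.symm
      · exact hagree q (by omega)
    have a0m := fourOddLetter_eq hN' (ι p0).2 (ι p1).2 hk0 hk1
      (by have h := congrArg Fin.val h00; rw [hxv, hχv, hκ0] at h; exact h)
    have a2m := fourOddLetter_eq hN' (ι p2).2 (ι p2).2 hk2 hk2
      (by have h := congrArg Fin.val h22; rw [hxv, hχv, hκq p2 (by omega) (by omega)] at h; exact h)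
    have b1m := fourOddLetter_eq hN' (ι p1).2 (ι p0).2 hk1 hk0
      (by have h := congrArg Fin.val h11; rw [hxv, hχv, hκ1] at h; exact h)
    have b3m := fourOddLetter_eq hN' (ι p3).2 (ι p3).2 hk3 hk3
      (by have h := congrArg Fin.val h33; rw [hxv, hχv, hκq p3 (by omega) (by omega)] at h; exact h)
    have hparity := oddThree_model_SS k0 k1 k2 k3 t hk0lt hk1lt hk2lt hk3lt hd3 hW01 hW02 hW03 hW12 hW13 hW23
      x02m x13m y12m y03m a0m a2m b1m b3m hdd
    rw [hχx, hpar]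
    by_cases hj2 : j % 2 = 0
    · rw [if_pos hj2, if_neg (by omega)]; linear_combination (-1 : ℂ) * hsq
    · rw [if_neg hj2, if_pos (by omega)]; linear_combination hsq
  · -- straight / crossed: `χ = x ∘ (p₁ p₃)`, `inv + t` odd
    have hχx : χ = x ∘ ⇑(Equiv.swap p1 p3) := by
      funext q
      show χ q = x (Equiv.swap p1 p3 q)
      by_cases hq : (q : ℕ) < 4
      · rcases hcases q hq with rfl | rfl | rfl | rfl
        · rw [Equiv.swap_apply_of_ne_of_ne hp01 hp03]; exact h00.symm
        · rw [Equiv.swap_apply_left]; exact h31.symm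
        · rw [Equiv.swap_apply_of_ne_of_ne hp12.symm hp23]; exact h22.symm
        · rw [Equiv.swap_apply_right]; exact h13.symm
      · rw [Equiv.swap_apply_of_ne_of_ne (hpne (by omega)) (hpne (by omega))]; exact hagree q (by omega)
    have a0m := fourOddLetter_eq hN' (ι p0).2 (ι p1).2 hk0 hk1
      (by have h := congrArg Fin.val h00; rw [hxv, hχv, hκ0] at h; exact h)
    have a2m := fourOddLetter_eq hN' (ι p2).2 (ι p2).2 hk2 hk2
      (by have h := congrArg Fin.val h22; rw [hxv, hχv, hκq p2 (by omega) (by omega)] at h; exact h)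
    have b1m := fourOddLetter_eq hN' (ι p1).2 (ι p3).2 hk1 hk3
      (by have h := congrArg Fin.val h13; rw [hxv, hχv, hκq p3 (by omega) (by omega)] at h; exact h)
    have b3m := fourOddLetter_eq hN' (ι p3).2 (ι p0).2 hk3 hk0
      (by have h := congrArg Fin.val h31; rw [hxv, hχv, hκ1] at h; exact h)
    have hparity := oddThree_model_SC k0 k1 k2 k3 t hk0lt hk1lt hk2lt hk3lt hd3 hW01 hW02 hW03 hW12 hW13 hW23
      x02m x13m y12m y03m a0m a2m b1m b3m hdd
    rw [hχx, wordBlockSign_comp_swap ℂ e hp13 hblk13 x, hpar]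
    by_cases hj2 : j % 2 = 0
    · rw [if_pos hj2, if_pos (by omega)]; linear_combination (-1 : ℂ) * hsq
    · rw [if_neg hj2, if_neg (by omega)]; linear_combination hsq
  · -- crossed / straight: `χ = x ∘ (p₀ p₂)`, `inv + t` odd
    have hχx : χ = x ∘ ⇑(Equiv.swap p0 p2) := by
      funext q
      show χ q = x (Equiv.swap p0 p2 q)
      by_cases hq : (q : ℕ) < 4
      · rcases hcases q hq with rfl | rfl | rfl | rfl
        · rw [Equiv.swap_apply_left]; exact h20.symm
        · rw [Equiv.swap_apply_of_ne_of_ne hp01.symm hp12]; exact h11.symm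
        · rw [Equiv.swap_apply_right]; exact h02.symm
        · rw [Equiv.swap_apply_of_ne_of_ne hp03.symm hp23.symm]; exact h33.symm
      · rw [Equiv.swap_apply_of_ne_of_ne (hpne (by omega)) (hpne (by omega))]; exact hagree q (by omega)
    have a0m := fourOddLetter_eq hN' (ι p0).2 (ι p2).2 hk0 hk2
      (by have h := congrArg Fin.val h02; rw [hxv, hχv, hκq p2 (by omega) (by omega)] at h; exact h)
    have a2m := fourOddLetter_eq hN' (ι p2).2 (ι p1).2 hk2 hk1
      (by have h := congrArg Fin.val h20; rw [hxv, hχv, hκ0] at h; exact h)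
    have b1m := fourOddLetter_eq hN' (ι p1).2 (ι p0).2 hk1 hk0
      (by have h := congrArg Fin.val h11; rw [hxv, hχv, hκ1] at h; exact h)
    have b3m := fourOddLetter_eq hN' (ι p3).2 (ι p3).2 hk3 hk3
      (by have h := congrArg Fin.val h33; rw [hxv, hχv, hκq p3 (by omega) (by omega)] at h; exact h)
    have hparity := oddThree_model_CS k0 k1 k2 k3 t hk0lt hk1lt hk2lt hk3lt hd3 hW01 hW02 hW03 hW12 hW13 hW23
      x02m x13m y12m y03m a0m a2m b1m b3m hdd
    rw [hχx, wordBlockSign_comp_swap ℂ e hp02 hblk02 x, hpar]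
    by_cases hj2 : j % 2 = 0
    · rw [if_pos hj2, if_pos (by omega)]; linear_combination (-1 : ℂ) * hsq
    · rw [if_neg hj2, if_neg (by omega)]; linear_combination hsq
  · -- crossed / crossed: `χ = x ∘ (p₀ p₂)(p₁ p₃)`, `inv + t` even
    have hχx : χ = (x ∘ ⇑(Equiv.swap p0 p2)) ∘ ⇑(Equiv.swap p1 p3) := by
      funext q
      show χ q = x (Equiv.swap p0 p2 (Equiv.swap p1 p3 q))
      by_cases hq : (q : ℕ) < 4
      · rcases hcases q hq with rfl | rfl | rfl | rfl
        · rw [Equiv.swap_apply_of_ne_of_ne hp01 hp03, Equiv.swap_apply_left]; exact h20.symm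
        · rw [Equiv.swap_apply_left, Equiv.swap_apply_of_ne_of_ne hp03.symm hp23.symm]; exact h31.symm
        · rw [Equiv.swap_apply_of_ne_of_ne hp12.symm hp23, Equiv.swap_apply_right]; exact h02.symm
        · rw [Equiv.swap_apply_right, Equiv.swap_apply_of_ne_of_ne hp01.symm hp12]; exact h13.symm
      · rw [Equiv.swap_apply_of_ne_of_ne (a := p1) (b := p3) (x := q) (hpne (by omega)) (hpne (by omega)),
          Equiv.swap_apply_of_ne_of_ne (a := p0) (b := p2) (x := q) (hpne (by omega)) (hpne (by omega))]
        exact hagree q (by omega)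
    have a0m := fourOddLetter_eq hN' (ι p0).2 (ι p2).2 hk0 hk2
      (by have h := congrArg Fin.val h02; rw [hxv, hχv, hκq p2 (by omega) (by omega)] at h; exact h)
    have a2m := fourOddLetter_eq hN' (ι p2).2 (ι p1).2 hk2 hk1
      (by have h := congrArg Fin.val h20; rw [hxv, hχv, hκ0] at h; exact h)
    have b1m := fourOddLetter_eq hN' (ι p1).2 (ι p3).2 hk1 hk3
      (by have h := congrArg Fin.val h13; rw [hxv, hχv, hκq p3 (by omega) (by omega)] at h; exact h)
    have b3m := fourOddLetter_eq hN' (ι p3).2 (ι p0).2 hk3 hk0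
      (by have h := congrArg Fin.val h31; rw [hxv, hχv, hκ1] at h; exact h)
    have hparity := oddThree_model_CC k0 k1 k2 k3 t hk0lt hk1lt hk2lt hk3lt hd3 hW01 hW02 hW03 hW12 hW13 hW23
      x02m x13m y12m y03m a0m a2m b1m b3m hdd
    rw [hχx, wordBlockSign_comp_swap ℂ e hp13 hblk13 (x ∘ ⇑(Equiv.swap p0 p2)),
      wordBlockSign_comp_swap ℂ e hp02 hblk02 x, hpar]
    by_cases hj2 : j % 2 = 0
    · rw [if_pos hj2, if_neg (by omega)]; linear_combination (-1 : ℂ) * hsq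
    · rw [if_neg hj2, if_pos (by omega)]; linear_combination hsq

end Summit.MatrixMultiplication.MatrixMultiplication.Theorems.ObstructionCalculus

end
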